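import Summits.ResolutionOfSingularities.ResolutionOfSingularities.Theorems.MarkedTransferCampaignW46TameInduction
import Literature.AlgebraicGeometry.Resolution.KollarNextLevelTame
import HarnessLib

/-!
# [OURS · L1 W4.6, rung (iv) «large characteristic», LEVEL 2] The tame induction descends a second dimension exactly
# when the level-1 orders are `< p` — which forces `p > b!` (cell res-hironaka, LADDER-RESOLUTION rung L, D-0089;
# slot W4.6, seat res-L1-s46-pv-7; host route MarkedTransfer, `--supports stmt-ResolutionOfSingularities-16155 --as helper`)

HONEST FRAMING. Nothing here is a statement of H. Hironaka's manuscript (2017-03-23, [Hironaka2017]) and nothing here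
asserts that any statement of it holds. OURS corollaries over the shared typed-procedure module
`MarkedTransferCampaignW46TypedProcedure` (res-L1-type-o1; typed CANDIDATE carriers `AmbientDatum`, `IdealExponent`,
`IdealExponent.sing`, `Regime.charGT` used as definitions) of this seat's `Literature/…/KollarNextLevelTame.lean` (p534123)
and `CoefficientIdealFactorialOrder.lean` (p528477). No premise of the manuscript, no FACT-LIST premise. AI review is
weaker than expert review. No `sorry`, no new definition; axioms standard.

## What this file pins

For a state `(A, E)`, `E = (J, b)`, over a PERFECT field `K` of characteristic `p`, and a regular hypersurface ideal `H` on
`Z` (order-one stalk generators; e.g. a maximal-contact hypersurface of regime (iv), `TameMaximalContact`):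

* `secondLevel_package` — for ANY ideal sheaf `N` on `S = V(H)` (e.g. the level-1 ideal `𝒞(J, b)·𝒪_S`) whose orders are
  `≤ μ' < p` (`1 ≤ μ'`): at every point of `S` the tame package holds INSIDE `S` — a maximal-contact hypersurface ideal
  `H₂` for `(N, μ')` on a neighbourhood in `S` (regular, `cosupp ⊆ V(H₂)`, `Kollar2007.IsMaxContact`) with the going-up
  property: the characteristic-zero induction descends a second dimension;
* `factorial_lt_char_of_secondLevel_tame` — if the level-1 ideal `𝒞(J, b)·𝒪_S` has all orders `≤ μ' < p` and `S` meets
  `Sing(E)` (with `b ≤ p`), then `b! ≤ μ' < p`: **the second level is tame only in `Regime.charGT n (fun _ b ↦ b !)`**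
  (`charGT_factorial_of_secondLevel_tame`) — the prior's V5 threshold as a necessary condition, kernel-checked.

## References (context; nothing is cited as a premise)

* J. Kollár (2007), 3.104 Step 2.2, §2.5 («characteristic `> 3!`»); BGMW (2011), Thm. 8.0.4 — through this seat's
  `KollarNextLevelTame.lean`. [cite: Kollar2007, 3.104 Step 2.2]
-/

noncomputable section

set_option linter.dupNamespace false -- mandated namespace of this single-conjunct summit

open CategoryTheory AlgebraicGeometry TopologicalSpace IsLocalRing

namespace Summit.ResolutionOfSingularities.ResolutionOfSingularities.Theorems
namespace CampaignW46
namespace TameSecondLevel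

open Literature.AlgebraicGeometry.Resolution
open Literature.AlgebraicGeometry.Hironaka2017.S02Preliminaries

universe u

variable {n : ℕ} {p : ℕ} [Fact p.Prime] {K : Type u} [Field K] [CharP K p]

/-- [OURS · L1 W4.6 (iv); NOT a statement of the manuscript] **The second level of the tame induction on a typed
ambient datum.** For `A` over a perfect field of characteristic `p`, a regular hypersurface ideal `H` on `Z` and an ideal
sheaf `N` on `S = V(H)` with `ord ≤ μ'` everywhere, `1 ≤ μ' < p`: at every `s ∈ S` there are an open `V ∋ s` of `S` and a
maximal-contact hypersurface ideal `H₂` for `(N|_V, μ')` in `S` (regular; `cosupp(N|_V, μ') ⊆ V(H₂)`; `IsMaxContact`) such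
that every resolution of `(V(H₂), 𝒞(N|_V, μ')|_{V(H₂)}, ∅, μ'!)` pushes forward to a resolution of `(V, N|_V, ∅, μ')`.
Instance of this seat's `Kollar2007.exists_maxContact_goingUp_nhd_subscheme_of_char`. [cite: Kollar2007, 3.104 Step 2.2] -/
theorem secondLevel_package [PerfectField K] (A : AmbientDatum p K) {H : A.Z.IdealSheafData}
    (hH : ∀ x ∈ H.support, ∃ v : A.Z.presheaf.stalk x,
      stalkIdeal H x = Ideal.span {v} ∧ v ∉ (maximalIdeal (A.Z.presheaf.stalk x)) ^ 2)
    (N : H.subscheme.IdealSheafData) {μ' : ℕ} (hμ' : 1 ≤ μ') (hμ'p : μ' < p)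
    (hmax : ∀ s : H.subscheme, idealOrder N s ≤ μ') (s : H.subscheme) :
    letI : A.Z.Over (Spec (.of K)) := ⟨A.hom⟩
    letI : H.subscheme.Over (Spec (.of K)) := ⟨H.subschemeι ≫ A.Z ↘ Spec (.of K)⟩
    ∃ (V : H.subscheme.Opens) (_ : s ∈ V) (H₂ : (V : Scheme.{u}).IdealSheafData),
      H₂ ≤ maxContactIdealSheaf (overHom K (V : Scheme.{u})) (N.comap V.ι) μ' ∧
        (∀ y ∈ H₂.support, ∃ v : (V : Scheme.{u}).presheaf.stalk y,
          stalkIdeal H₂ y = Ideal.span {v} ∧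
            v ∉ (maximalIdeal ((V : Scheme.{u}).presheaf.stalk y)) ^ 2) ∧
        ((⟨N, [], μ'⟩ : MarkedIdeal H.subscheme).comap V.ι).support ⊆ (H₂.support : Set V) ∧
        Kollar2007.IsMaxContact (N.comap V.ι) μ' H₂ ∧
        ∀ (_ : DecidableEq (V : Scheme.{u}).IdealSheafData) (t : CentreSeq H₂.subscheme),
          t.IsResolutionOf
              ((⟨N.comap V.ι, [], μ'⟩ : MarkedIdeal (V : Scheme.{u})).coeffRestrict
                (overHom K (V : Scheme.{u})) H₂) →
            (t.pushforward H₂.subschemeι).IsResolutionOf ⟨N.comap V.ι, [], μ'⟩ := by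
  letI : A.Z.Over (Spec (.of K)) := ⟨A.hom⟩
  haveI : Smooth (A.Z ↘ Spec (.of K)) := A.smooth
  exact Kollar2007.exists_maxContact_goingUp_nhd_subscheme_of_char K A.Z p hH N hμ' (Or.inr hμ'p) hmax s

/-- [OURS · L1 W4.6 (iv); NOT a statement of the manuscript] **The second level is tame only if `p > b!`.** For `(A, E)`,
`E = (J, b)` with `b ≤ p`, over a perfect field of characteristic `p`, a regular hypersurface ideal `H` on `Z`, and the
level-1 ideal `N = 𝒞(J, b)·𝒪_S` on `S = V(H)` (tree `MarkedIdeal.coeff`, restricted): if all orders of `N` are `≤ μ'` with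
`μ' < p` and some point `s ∈ S` lies over `Sing(E)`, then `b! ≤ μ'` and `b! < p`. Instance of this seat's
`Kollar2007.factorial_lt_char_of_nextLevel_tame`. [cite: Kollar2007, §2.5 (p. 81)] -/
theorem factorial_lt_char_of_secondLevel_tame [PerfectField K] (A : AmbientDatum p K) (E : IdealExponent A.Z)
    (hbp : E.b ≤ p) {H : A.Z.IdealSheafData}
    (hH : ∀ x ∈ H.support, ∃ v : A.Z.presheaf.stalk x,
      stalkIdeal H x = Ideal.span {v} ∧ v ∉ (maximalIdeal (A.Z.presheaf.stalk x)) ^ 2)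
    {μ' : ℕ} (hμ'p : μ' < p)
    (hmax : letI : A.Z.Over (Spec (.of K)) := ⟨A.hom⟩
      ∀ s : H.subscheme,
        idealOrder (((⟨E.J, [], E.b⟩ : MarkedIdeal A.Z).coeff (overHom K A.Z)).comap H.subschemeι).ideal s ≤ μ')
    {s : H.subscheme} (hs : (H.subschemeι s : A.Z) ∈ E.sing) :
    E.b.factorial ≤ μ' ∧ E.b.factorial < p := by
  letI : A.Z.Over (Spec (.of K)) := ⟨A.hom⟩
  haveI : Smooth (A.Z ↘ Spec (.of K)) := A.smooth
  exact Kollar2007.factorial_lt_char_of_nextLevel_tame K A.Z p E.J hbp hH hμ'p hmax hs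

/-- [OURS · L1 W4.6 (iv)] … in the typed regime vocabulary: under the hypotheses of
`factorial_lt_char_of_secondLevel_tame` the state lies in the factorial regime `Regime.charGT n (fun _ b ↦ b !)` of
the prior's V5. [folklore] -/
theorem charGT_factorial_of_secondLevel_tame [PerfectField K] (A : AmbientDatum p K) (E : IdealExponent A.Z)
    (hbp : E.b ≤ p) {H : A.Z.IdealSheafData}
    (hH : ∀ x ∈ H.support, ∃ v : A.Z.presheaf.stalk x,
      stalkIdeal H x = Ideal.span {v} ∧ v ∉ (maximalIdeal (A.Z.presheaf.stalk x)) ^ 2)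
    {μ' : ℕ} (hμ'p : μ' < p)
    (hmax : letI : A.Z.Over (Spec (.of K)) := ⟨A.hom⟩
      ∀ s : H.subscheme,
        idealOrder (((⟨E.J, [], E.b⟩ : MarkedIdeal A.Z).coeff (overHom K A.Z)).comap H.subschemeι).ideal s ≤ μ')
    {s : H.subscheme} (hs : (H.subschemeι s : A.Z) ∈ E.sing) :
    Regime.charGT (p := p) (K := K) n (fun _ b => b.factorial) A E :=
  (factorial_lt_char_of_secondLevel_tame A E hbp hH hμ'p hmax hs).2

end TameSecondLevel
end CampaignW46
end Summit.ResolutionOfSingularities.ResolutionOfSingularities.Theorems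

end
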